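/-
Copyright: rh-split cell (screw, prover seat l22-w3) gen 0, 2026-08-27.  D-0145 line L22
(route-RiemannHypothesis-ScrewQuarticNodes, desk rh-idea-9).  Corollaries of the landed RH-free
Nyquist door `ScrewQuarticNodesSparseNodeDoor.sparseNodeDoor` (stmt-RiemannHypothesis-22169): every
statement below is a DETECTION theorem (hypotheses about `ζ`'s own screw function imply RH).  RH is
not proved by any of this; nothing here bears on the truth of RH.
-/
import Summits.RiemannHypothesis.RiemannHypothesis.Theorems.ScrewQuarticNodesSparseNodeDoor

/-!
# Route ScrewQuarticNodes (L22) — robust INTEGER and POWER-NODE doors (supports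
# stmt-RiemannHypothesis-22169 `SparseNodeDoor`)

`Ψ = zetaScrew` is Suzuki's screw function of `ζ` (Suzuki2023 (1.1)).  The landed door
`sparseNodeDoor` says: for `K > 0` and a node set `N ⊆ ℝ` meeting every
`[a, a + √(K/(e^{(a+2)/2}+1))]` for large `a`, `Ψ ≥ -K` on `N` implies RH.  This file only
POST-PROCESSES that theorem (no new Taylor / Landau argument):

* `explicit_gap_le`, `sparseNodeDoor_explicit` — the admissible gap in closed exponential form:
  `√(K/(2e))·e^{-a/4} ≤ √(K/(e^{(a+2)/2}+1))` for `a ≥ -2`, so a node set meeting every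
  `[a, a + √(K/(2e))·e^{-a/4}]` for large `a` is admissible.
* `integerSparseDoor` — the INTEGER `x^{3/4}`-SPARSE DOOR: if `S ⊆ ℕ` meets every
  `[x, x + √(K/(2e))·x^{3/4}]` for large real `x` and `Ψ(log m) ≥ -K` on `S`, then RH.  This is the
  sampling law sitting between the tree's `IntegerScrew.DiscreteLandau` (ALL integers, `x`-gap `1`,
  slack `0`) and the geometric lattices of the screw-bridge column (`x`-gap `≍ x`, provably blind,
  B16 `ScrewLatticeWolffModel`).
* `powerNodeDoor` — POWER NODES `x = j^k`, `k ∈ {1, 2, 3}`: for EVERY `K > 0`,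
  `(∀ j ≥ 1, Ψ(k·log j) ≥ -K) → RH` (own density lemma: the `t`-gap `k·e^{-t/k}` of these nodes is
  eventually below `√(K/(2e))·e^{-t/4}` because `k < 4`).  `k = 1` is the ROBUST DISCRETE LANDAU
  door `(∀ m ≥ 1, Ψ(log m) ≥ -K) → RH` with arbitrary slack `K` (`integerNodeDoor`; it also follows
  from `IntegerScrewDiscreteLandau.nodeSlack` + `robustLandau`).
* `quarticNodeDoor_of_dense` — the route's own threshold case `k = 4` made ROBUST IN `K` over the
  route's support `QuarticNodesDense` (stmt-22171, stated at `K = 100`): `QuarticNodesDense →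
  ∀ K > 0, (∀ j ≥ 1, Ψ(4·log j) ≥ -K) → RH` (`K ≤ 100` by weakening the node bound, `K > 100` by
  monotonicity of the admissible gap in `K`).  No density is re-proved here; `QuarticNodesDense`
  stays the route's item.

Beyond `k = 4` the node gap `k·e^{-t/k}` exceeds the Nyquist gap `≍ e^{-t/4}` and the door is
silent (the route's sharpness note).  References: Suzuki2023 (1.1), Thm 1.7; MontgomeryVaughan2007
§15.1.  Axioms: propext, Classical.choice, Quot.sound.
-/

noncomputable section

open Real Set

namespace Summit.RiemannHypothesis.RiemannHypothesis.Theorems.ScrewQuarticNodesPowerNodeDoors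

open Literature.NumberTheory.LFunctions
open Summit.RiemannHypothesis.RiemannHypothesis.Theorems.ScrewQuarticNodesSparseNodeDoor
  (sparseNodeDoor)

/-! ## The admissible gap in closed form -/

/-- For `a ≥ -2` and `K ≥ 0`: `√(K/(2e))·e^{-a/4} ≤ √(K/(e^{(a+2)/2}+1))` (square both sides:
`e^{(a+2)/2} + 1 ≤ 2e^{(a+2)/2}` iff `1 ≤ e^{(a+2)/2}`). -/
theorem explicit_gap_le {K a : ℝ} (hK : 0 ≤ K) (ha : -2 ≤ a) :
    Real.sqrt (K / (2 * Real.exp 1)) * Real.exp (-(a / 4)) ≤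
      Real.sqrt (K / (Real.exp ((a + 2) / 2) + 1)) := by
  apply Real.le_sqrt_of_sq_le
  have hE : Real.exp ((a + 2) / 2) = Real.exp 1 * Real.exp (a / 2) := by
    rw [← Real.exp_add]; ring_nf
  have h1 : 1 ≤ Real.exp ((a + 2) / 2) := Real.one_le_exp (by linarith)
  have hsq : (Real.sqrt (K / (2 * Real.exp 1)) * Real.exp (-(a / 4))) ^ 2 =
      K / (2 * Real.exp ((a + 2) / 2)) := by
    rw [mul_pow, Real.sq_sqrt (by positivity), sq, ← Real.exp_add, hE,
      show -(a / 4) + -(a / 4) = -(a / 2) from by ring, Real.exp_neg]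
    field_simp
  rw [hsq]
  have h2 : Real.exp ((a + 2) / 2) + 1 ≤ 2 * Real.exp ((a + 2) / 2) := by linarith
  exact div_le_div_of_nonneg_left hK (by positivity) h2

/-- **Nyquist door, explicit gap.**  For `K > 0` and `N ⊆ ℝ` meeting every
`[a, a + √(K/(2e))·e^{-a/4}]` for all large `a`, the node bound `Ψ ≥ -K` on `N` implies RH.
(`sparseNodeDoor` with `explicit_gap_le`; thresholds are pushed past `-2`.)  Detection theorem;
nothing here bears on the truth of RH. -/
theorem sparseNodeDoor_explicit (K : ℝ) (N : Set ℝ) (hK : 0 < K)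
    (hN : ∃ T₀ : ℝ, ∀ a : ℝ, T₀ ≤ a →
      ∃ x ∈ N, a ≤ x ∧ x ≤ a + Real.sqrt (K / (2 * Real.exp 1)) * Real.exp (-(a / 4)))
    (hΨN : ∀ x ∈ N, -K ≤ zetaScrew x) : _root_.RiemannHypothesis := by
  obtain ⟨T₀, hT₀⟩ := hN
  refine sparseNodeDoor K N hK ⟨max T₀ (-2), fun a ha => ?_⟩ hΨN
  obtain ⟨x, hxN, hax, hxa⟩ := hT₀ a ((le_max_left _ _).trans ha)
  exact ⟨x, hxN, hax, hxa.trans (by linarith [explicit_gap_le hK.le ((le_max_right _ _).trans ha)])⟩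

/-! ## The integer `x^{3/4}`-sparse door -/

/-- Logarithms compress the `x`-window `[x, x + c·x^{3/4}]`, `x = e^a`, into the `t`-window
`[a, a + c·e^{-a/4}]`: if `e^a ≤ m ≤ e^a + c·(e^a)^{3/4}` with `c ≥ 0` then
`a ≤ log m ≤ a + c·e^{-a/4}` (`log(1+u) ≤ u`). -/
theorem log_mem_window {a c m : ℝ} (hc : 0 ≤ c) (h1 : Real.exp a ≤ m)
    (h2 : m ≤ Real.exp a + c * (Real.exp a) ^ (3 / 4 : ℝ)) :
    a ≤ Real.log m ∧ Real.log m ≤ a + c * Real.exp (-(a / 4)) := by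
  have hm : 0 < m := (Real.exp_pos a).trans_le h1
  refine ⟨by simpa using Real.log_le_log (Real.exp_pos a) h1, ?_⟩
  have h34 : (Real.exp a) ^ (3 / 4 : ℝ) = Real.exp a * Real.exp (-(a / 4)) := by
    rw [← Real.exp_mul, ← Real.exp_add]; ring_nf
  have hu : 0 ≤ c * Real.exp (-(a / 4)) := by positivity
  have hfac : Real.exp a + c * (Real.exp a) ^ (3 / 4 : ℝ) =
      Real.exp a * (1 + c * Real.exp (-(a / 4))) := by rw [h34]; ring
  calc Real.log m ≤ Real.log (Real.exp a + c * (Real.exp a) ^ (3 / 4 : ℝ)) :=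
        Real.log_le_log hm h2
    _ = a + Real.log (1 + c * Real.exp (-(a / 4))) := by
        rw [hfac, Real.log_mul (Real.exp_pos a).ne' (by positivity), Real.log_exp]
    _ ≤ a + c * Real.exp (-(a / 4)) := by
        have := Real.log_le_sub_one_of_pos (show 0 < 1 + c * Real.exp (-(a / 4)) by positivity)
        linarith

/-- **INTEGER `x^{3/4}`-SPARSE DOOR.**  Let `K > 0` and `S ⊆ ℕ` meet every window
`[x, x + √(K/(2e))·x^{3/4}]` for all large real `x`.  If `Ψ(log m) ≥ -K` for every `m ∈ S`, the
Riemann hypothesis holds.  (Nodes `N = log S` in `sparseNodeDoor_explicit`, via `log_mem_window`.)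
The tree's `IntegerScrew.DiscreteLandau` is the case `S = ℕ₊`, `K = 0`; `x`-gaps `≍ x` are blind
(B16).  Detection theorem; nothing here bears on the truth of RH. -/
theorem integerSparseDoor (K : ℝ) (S : Set ℕ) (hK : 0 < K)
    (hS : ∃ X₀ : ℝ, ∀ x : ℝ, X₀ ≤ x →
      ∃ m ∈ S, x ≤ (m : ℝ) ∧ (m : ℝ) ≤ x + Real.sqrt (K / (2 * Real.exp 1)) * x ^ (3 / 4 : ℝ))
    (hΨS : ∀ m ∈ S, -K ≤ zetaScrew (Real.log m)) : _root_.RiemannHypothesis := by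
  obtain ⟨X₀, hX₀⟩ := hS
  refine sparseNodeDoor_explicit K ((fun m : ℕ => Real.log (m : ℝ)) '' S) hK
    ⟨Real.log (max X₀ 1), fun a ha => ?_⟩ ?_
  · have hx : X₀ ≤ Real.exp a := by
      have : max X₀ 1 ≤ Real.exp a := by
        have h := Real.exp_le_exp.mpr ha
        rwa [Real.exp_log (lt_of_lt_of_le one_pos (le_max_right X₀ 1))] at h
      exact (le_max_left _ _).trans this
    obtain ⟨m, hmS, h1, h2⟩ := hX₀ (Real.exp a) hx
    obtain ⟨hlo, hhi⟩ := log_mem_window (Real.sqrt_nonneg _) h1 h2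
    exact ⟨Real.log m, ⟨m, hmS, rfl⟩, hlo, hhi⟩
  · rintro x ⟨m, hmS, rfl⟩
    exact hΨS m hmS

/-! ## Power nodes `x = j^k`, `k ≤ 3` -/

/-- The `t`-gap `k·e^{-a/k}` of the nodes `k·log j` is eventually below any `c·e^{-a/4}`, `c > 0`,
when `1 ≤ k ≤ 3`: for `a ≥ 12k/c` (so `a > 0`), `e^{a/k - a/4} ≥ e^{a/12} ≥ a/12 ≥ k/c`. -/
theorem power_gap_eventually {k : ℕ} (hk1 : 1 ≤ k) (hk3 : k ≤ 3) {c : ℝ} (hc : 0 < c) :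
    ∀ a : ℝ, 12 * k / c ≤ a → (k : ℝ) * Real.exp (-(a / k)) ≤ c * Real.exp (-(a / 4)) := by
  intro a ha
  have hk : (0 : ℝ) < k := by exact_mod_cast hk1
  have hk3' : (k : ℝ) ≤ 3 := by exact_mod_cast hk3
  have ha0 : 0 ≤ a := le_trans (by positivity) ha
  -- `a/12 ≤ a/k - a/4`
  have hexp : a / 12 ≤ a / k - a / 4 := by
    have : a / 3 ≤ a / k := div_le_div_of_nonneg_left ha0 hk hk3'
    linarith
  -- `k/c ≤ a/12 ≤ e^{a/12} ≤ e^{a/k - a/4}`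
  have h1 : (k : ℝ) / c ≤ a / 12 := by
    rw [div_le_iff₀ hc]; rw [div_le_iff₀ hc] at ha; linarith
  have h2 : a / 12 ≤ Real.exp (a / k - a / 4) :=
    (by linarith [Real.add_one_le_exp (a / 12)] : a / 12 ≤ Real.exp (a / 12)).trans
      (Real.exp_le_exp.mpr hexp)
  have h3 : (k : ℝ) / c ≤ Real.exp (a / k - a / 4) := h1.trans h2
  rw [div_le_iff₀ hc] at h3
  have h4 : Real.exp (a / k - a / 4) * Real.exp (-(a / k)) = Real.exp (-(a / 4)) := by
    rw [← Real.exp_add]; ring_nf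
  calc (k : ℝ) * Real.exp (-(a / k)) ≤ Real.exp (a / k - a / 4) * c * Real.exp (-(a / k)) := by
        gcongr
    _ = c * Real.exp (-(a / 4)) := by rw [mul_comm _ c, mul_assoc, h4]

/-- Density of the power nodes: for `1 ≤ k ≤ 3` and `c > 0`, every `[a, a + c·e^{-a/4}]` with
`a ≥ 12k/c` contains a node `k·log j`, `j ≥ 1` (take `j = ⌈e^{a/k}⌉`). -/
theorem power_nodes_dense {k : ℕ} (hk1 : 1 ≤ k) (hk3 : k ≤ 3) {c : ℝ} (hc : 0 < c) :
    ∀ a : ℝ, 12 * k / c ≤ a →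
      ∃ j : ℕ, 1 ≤ j ∧ a ≤ k * Real.log j ∧ k * Real.log j ≤ a + c * Real.exp (-(a / 4)) := by
  intro a ha
  have hk : (0 : ℝ) < k := by exact_mod_cast hk1
  set j : ℕ := ⌈Real.exp (a / k)⌉₊ with hj
  have hjpos : 0 < j := Nat.ceil_pos.mpr (Real.exp_pos _)
  have hjR : (0 : ℝ) < j := by exact_mod_cast hjpos
  have hge : Real.exp (a / k) ≤ j := Nat.le_ceil _
  have hlt : (j : ℝ) < Real.exp (a / k) + 1 := Nat.ceil_lt_add_one (Real.exp_pos _).le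
  refine ⟨j, hjpos, ?_, ?_⟩
  · have h := Real.log_le_log (Real.exp_pos _) hge
    rw [Real.log_exp] at h
    have : (k : ℝ) * (a / k) = a := by field_simp
    calc a = k * (a / k) := this.symm
      _ ≤ k * Real.log j := by gcongr
  · have hfac : Real.exp (a / k) + 1 = Real.exp (a / k) * (1 + Real.exp (-(a / k))) := by
      rw [mul_add, mul_one, ← Real.exp_add]; simp
    have hlog : Real.log j ≤ a / k + Real.exp (-(a / k)) := by
      calc Real.log j ≤ Real.log (Real.exp (a / k) + 1) := Real.log_le_log hjR hlt.le
        _ = a / k + Real.log (1 + Real.exp (-(a / k))) := by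
            rw [hfac, Real.log_mul (Real.exp_pos _).ne' (by positivity), Real.log_exp]
        _ ≤ a / k + Real.exp (-(a / k)) := by
            have := Real.log_le_sub_one_of_pos (show 0 < 1 + Real.exp (-(a / k)) by positivity)
            linarith
    have hgap := power_gap_eventually hk1 hk3 hc a ha
    have : (k : ℝ) * (a / k) = a := by field_simp
    calc (k : ℝ) * Real.log j ≤ k * (a / k + Real.exp (-(a / k))) := by gcongr
      _ = a + k * Real.exp (-(a / k)) := by rw [mul_add, this]
      _ ≤ a + c * Real.exp (-(a / 4)) := by linarith

/-- **POWER-NODE DOOR (`x = j^k`, `k ∈ {1,2,3}`).**  For every `K > 0`: if `Ψ(k·log j) ≥ -K` for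
all integers `j ≥ 1`, the Riemann hypothesis holds.  (`sparseNodeDoor_explicit` on
`N = {k·log j : j ≥ 1}` with `power_nodes_dense` at `c = √(K/(2e))`.)  The threshold exponent
`k = 4` is the route's own conjunct pair (`quarticNodeDoor_of_dense`).  Detection theorem; nothing
here bears on the truth of RH. -/
theorem powerNodeDoor (k : ℕ) (hk1 : 1 ≤ k) (hk3 : k ≤ 3) (K : ℝ) (hK : 0 < K)
    (hΨ : ∀ j : ℕ, 1 ≤ j → -K ≤ zetaScrew (k * Real.log j)) : _root_.RiemannHypothesis := by
  have hc : 0 < Real.sqrt (K / (2 * Real.exp 1)) := Real.sqrt_pos.mpr (by positivity)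
  refine sparseNodeDoor_explicit K {x : ℝ | ∃ j : ℕ, 1 ≤ j ∧ x = k * Real.log j} hK
    ⟨12 * k / Real.sqrt (K / (2 * Real.exp 1)), fun a ha => ?_⟩ ?_
  · obtain ⟨j, hj, h1, h2⟩ := power_nodes_dense hk1 hk3 hc a ha
    exact ⟨k * Real.log j, ⟨j, hj, rfl⟩, h1, h2⟩
  · rintro x ⟨j, hj, rfl⟩
    exact hΨ j hj

/-- **ROBUST DISCRETE LANDAU (`k = 1`).**  For every `K > 0`: `Ψ(log m) ≥ -K` for all integers
`m ≥ 1` implies RH — the tree's `IntegerScrew.DiscreteLandau` (`K = 0`) with an arbitrary slack.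
Detection theorem; nothing here bears on the truth of RH. -/
theorem integerNodeDoor (K : ℝ) (hK : 0 < K)
    (hΨ : ∀ m : ℕ, 1 ≤ m → -K ≤ zetaScrew (Real.log m)) : _root_.RiemannHypothesis :=
  powerNodeDoor 1 le_rfl (by norm_num) K hK (fun j hj => by simpa using hΨ j hj)

/-- **SQUARE NODES (`k = 2`)**: `Ψ(2·log j) ≥ -K` for all `j ≥ 1` (one-sided boundedness of `Ψ` at
`x = j²`) implies RH, for every `K > 0`.  Nothing here bears on the truth of RH. -/
theorem squareNodeDoor (K : ℝ) (hK : 0 < K)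
    (hΨ : ∀ j : ℕ, 1 ≤ j → -K ≤ zetaScrew (2 * Real.log j)) : _root_.RiemannHypothesis :=
  powerNodeDoor 2 (by norm_num) (by norm_num) K hK (fun j hj => by simpa using hΨ j hj)

/-- **CUBE NODES (`k = 3`)**: `Ψ(3·log j) ≥ -K` for all `j ≥ 1` (one-sided boundedness of `Ψ` at
`x = j³`) implies RH, for every `K > 0`.  Nothing here bears on the truth of RH. -/
theorem cubeNodeDoor (K : ℝ) (hK : 0 < K)
    (hΨ : ∀ j : ℕ, 1 ≤ j → -K ≤ zetaScrew (3 * Real.log j)) : _root_.RiemannHypothesis :=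
  powerNodeDoor 3 (by norm_num) le_rfl K hK (fun j hj => by simpa using hΨ j hj)

/-! ## The quartic case, robust in `K` -/

/-- **QUARTIC NODES, ROBUST IN `K`.**  Given the route's support `QuarticNodesDense` (the nodes
`4·log j` meet every `[a, a + √(100/(e^{(a+2)/2}+1))]` for large `a`), for EVERY `K > 0` the node
bound `Ψ(4·log j) ≥ -K` (`j ≥ 1`) implies RH: for `K ≤ 100` weaken the bound to `-100` and use the
door at `100`; for `K > 100` use the door at `K`, whose admissible gap is larger.  So the route's
declared residual may be relaxed from `Ψ(4 log j) ≥ 0` to `≥ -K` for any fixed `K`.  Conditional on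
`QuarticNodesDense` (stmt-22171, provable-now); detection theorem; nothing here bears on the truth
of RH. -/
theorem quarticNodeDoor_of_dense
    (hD : Summit.RiemannHypothesis.RiemannHypothesis.Theses.ScrewQuarticNodes.QuarticNodesDense)
    (K : ℝ) (hK : 0 < K) (hΨ : ∀ j : ℕ, 1 ≤ j → -K ≤ zetaScrew (4 * Real.log j)) :
    _root_.RiemannHypothesis := by
  have hK' : 0 < max K 100 := lt_max_of_lt_left hK
  refine sparseNodeDoor (max K 100) {x : ℝ | ∃ j : ℕ, 1 ≤ j ∧ x = 4 * Real.log j} hK' ?_ ?_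
  · obtain ⟨T₀, hT⟩ := hD
    refine ⟨T₀, fun a ha => ?_⟩
    obtain ⟨j, hj, h1, h2⟩ := hT a ha
    refine ⟨4 * Real.log j, ⟨j, hj, rfl⟩, h1, h2.trans ?_⟩
    gcongr
    exact le_max_right _ _
  · rintro x ⟨j, hj, rfl⟩
    have h := hΨ j hj
    have : K ≤ max K 100 := le_max_left _ _
    linarith

end Summit.RiemannHypothesis.RiemannHypothesis.Theorems.ScrewQuarticNodesPowerNodeDoors

end
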